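import Summits.HodgeConjecture.HodgeConjecture.Theorems.H413ThetaDistAtLineArchTorusEigen
import Summits.HodgeConjecture.HodgeConjecture.Theorems.H413ThetaDistAtLineCCOfWeightOne
import Summits.HodgeConjecture.HodgeConjecture.Theorems.H413IndexEmptyOfEmbeddingNe
import Summits.HodgeConjecture.HodgeConjecture.Theorems.H413AdmissibleLineOrient
import Summits.HodgeConjecture.CorCM.Hyp413.A3Liu413FaceTypes
import Summits.HodgeConjecture.HodgeConjecture.Theorems.H413FinPairRepGramTransport
import HarnessLib

/-!
# FLOOR-0 P4, S4b `(χ)`+`(N)` row — (A-PIN): the archimedean `U(W)`-torus acts on the slot family by `(ĉ ∘ ι_W)⁻¹` at `∞`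
# (the `heig` input of F0P4-p05's `chiN_of_rankOneContCM`, in the twist character's own currency)

Cell hodgecm-mathlib (D-0151), FLOOR 0, crux item H413 = stmt-HodgeConjecture-24833; programme P4, line
`Cruxes/H413/Lines/F0_P4AdmissibleOccursInH1.lean` (ED. 3.2 → 3.3), stub S4b `stub_T3a_holThetaAtAdmissibleLineOfRallisAt`, row `(χ)`+`(N)` =
the hypothesis `hχN` of ★-pending `ThetaJunction.exists_holTheta_admissibleLine_of_chiN` (F0P4-p01 (g2)), produced by F0P4-p05 (g2)'s
`Theorems/H413ChiNRowAtPin.lean :: chiN_of_rankOneContCM`.  Author F0P4-p04 (g3) ((A) desk heir); F0P4-p05 (g2) FILE 3 design census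
2026-08-31T01:58:39Z «ASK (A-PIN) → p04», F0P4-plan (g3) word 02:05:35Z (1).  `--supports stmt-HodgeConjecture-24833 --as helper`.  DEF-FREE, KERNEL ONLY.

WHY.  Brick 7 (★ `ThetaNonvanishing.thetaLift_charCM_tmul_ne_zero_of_finCoeff_ne_zero`) at the pin needs `heig : ω_∞(1, a′) Φ_∞ = χ_∞(a′) • Φ_∞` for the
ARCHIMEDEAN component `χ_∞` of the automorphic character `χ₂ = (ĉ ∘ ι_W)⁻¹ · (χ♭ ∘ fin)` of `[U(⟨a⟩)]` (★ `RallisTransport.exists_pinDual`, F0P4-p05), i.e.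
`χ_∞(a′) = (ĉ (ι_W (a′)_𝔸))⁻¹`.  ★ `Theorems/H413ThetaDistAtLineArchTorusEigen.cmArchWeilRep_one_blockFamilyOfAt` (F0P4-p04 (g2)) gives `heig` with
`χ_∞ := lineC ∘ det_∞` ((F1)'s centre eigen-character of the splitting OF RECORD `s₀ = splittingOf hGR₀`); the two agree because
(i) in `G₁(𝔸) = U(J_V ⊗ J_W)(𝔸)` the pair elements `1 ⊗ a′_∞` and `(det_∞ a′ · 1_V)_∞ ⊗ 1` COINCIDE (★ `ThetaNonvanishing.adelicInr_archToAdelic_line`,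
★ `UnitaryGroup.archToAdelic_archCenter`: `ι_W((a′)_𝔸) = ι_V(u_t · 1_V)`, `t = det_∞ a′`), and (ii) the CENTRE IDENTITY (CC₀) of ★
`Theorems/H413ThetaDistAtLineCCOfWeightOne.CC_of_weightOne_of_twist_eq`: `ĉ(ι_V(u_t · 1_V)) · lineC t = 1` for Liu's `μ`-splitting `ι_μ = s₀ ⊗ ĉ` with `μ`
conjugate symplectic OF WEIGHT ONE at a `μ`-ADMISSIBLE line, `(mk ι₁).embedding ∈ Φ_μ`.

* §1 (model currency, any CM field `L`, any real scalar `a`, any weight-one datum):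
  `adelicInr_archToAdelic_eq_adelicInl_CMCenter` — `ι_W((a′)_𝔸) = ι_V(CMCenter (infUnitToOne (det_∞ a′)))`;
  **`lineC_archDet_eq_inv_twistChar`** — `lineC V a hGR (det_∞ a′) = (ĉ (ι_W (a′)_𝔸))⁻¹`;
  **`cmArchWeilRep_one_blockFamilyOfAt_eq_inv_twistChar_smul`** — `ω_{s₀}(1, a′) Φ_∞(ℓ) = (ĉ (ι_W (a′)_𝔸))⁻¹ • Φ_∞(ℓ)` for every slot-sign frame `eR, eS`.
* §2 AT THE PIN, in F0P4-p05's letter VERBATIM (binders `(hDel F V a₀ Φ i t hw hι e a he hae) (ha ha0 hpos ĉ hĉ)` of `hχN`):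
  **`cmArchWeilRep_one_blockFamilyOfAt_pin`** — `∀ a′ ℓ, cmArchWeilRep (K F) e₁ (frameD V) … (lineVec ↑a) (fun _ => ha) (fun _ => ha0) (compat_line₀ V Φ ι₁ ↑a ha ha0) (1, a′)
  (blockFamilyOfAt … (posIdxEquivUnit hpos) (negIdxEquivEmpty hpos) (degOnePDual Empty) (binvPi 1) ℓ) = (((ĉ (adelicInr (archToAdelic a′)))⁻¹ : ℂˣ) : ℂ) • blockFamilyOfAt … ℓ`
  (weight one ∕ admissibility ∕ `ι₁ ∈ Φ_μ` read off the triple exactly as in F0P4-p01's closer: ★ `IsAdmissibleElement.mem_iff_im_pos`,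
  ★ `IndexOrientation.embedding_mk_eq_of_indexOfRecord`, `IsConjugateSymplectic.hasCMType_cmType`); and `lineC_archDet_pin` (the scalar identity alone).

HC_CM is proved only modulo the printed citations until rung 0 closes; this file proves nothing about them.

## References
* [Liu2021] Y. Liu, Camb. J. Math. 9 (2021) = arXiv:2102.11518, App. D §D.1 Step 3 (l. 5219–5221), Lem. D.2; Def. 4.12; proof of Prop. 4.13 (l. 2145).
* [GelbartRogawski1991] S. Gelbart, J. Rogawski, Invent. Math. 105 (1991), §3.1 p. 454–455, Prop. 3.1.1, Remark p. 457 L4–13.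
* [KonnoKonno2007] Lemma 5.2, Thm 5.4.  [BorelJacquet1979] §4.1.  [Mok2014] §1 Notation p. 5.
* Tree (all ★): `Theorems/H413ThetaDistAtLineArchTorusEigen` (`cmArchWeilRep_one_blockFamilyOfAt`), `Theorems/H413ThetaDistAtLineCCOfWeightOne`
  (`CC_of_weightOne_of_twist_eq`), `Theorems/H413ArchTorusCentreSwap` (`adelicInr_archToAdelic_line`), `Automorphic/UnitaryGroupArchCenter`
  (`archToAdelic_archCenter`), `Theorems/H413IndexEmptyOfEmbeddingNe` ∕ `H413AdmissibleLineOrient` (pin read-offs), `CorCM/Hyp413/A3Liu413FaceTypes` (`datum413`).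
-/

set_option autoImplicit false
set_option linter.dupNamespace false

noncomputable section

open NumberField hiding relNormOneIdeles relNormOneRat probHaarRelNormOneQuot
open _root_.NumberField.InfinitePlace _root_.NumberField.mixedEmbedding MeasureTheory MulAction IsDedekindDomain
open scoped Matrix TensorProduct Classical SchwartzMap
open Literature.NumberTheory.Automorphic Literature.NumberTheory.Automorphic.UnitaryGroup Literature.NumberTheory.Weil1964
open Literature.NumberTheory.GelbartRogawski1991 Literature.NumberTheory.GelbartRogawski1991.UnitaryDualPair
open Literature.NumberTheory.GelbartRogawski1991.GRConstruction
open Literature.NumberTheory.Automorphic.Liu2021.Def411WeilCarriersDoubling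
open Literature.NumberTheory.Automorphic.IdeleClassGroup
open Literature.NumberTheory.GaloisRepresentations
open Literature.RepresentationTheory.HarrisKudlaSweet1996
open Literature.Analysis.SegalBargmann
open HodgeCM HodgeCM.Adelic HodgeCM.PerL34 HodgeCM.Model HodgeCM.Model.HypCensus HodgeCM.Model.ArchSideTerm

namespace Summit.HodgeConjecture.HodgeConjecture.Cruxes.H413.ThetaDistAtLine

/-! ## §1 Model currency: `lineC ∘ det_∞ = (ĉ ∘ ι_W)⁻¹` at `∞` -/

section Model

variable {L : CMField} {ι₁ : L →+* ℂ} (V : HermSpace3 L ι₁) (a : (L : Type))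
  (ha : IsCMField.complexConj (L : Type) a = a) (ha0 : a ≠ 0)
  (hGR : (cmSplittingDatum (L : Type) e₁ (frameD V) (frameD_real V) (frameD_ne V) (lineVec (L : Type) a) (fun _ => ha)
    (fun _ => ha0)).CompatibleSplitting)

/-- **`ι_W((a′)_𝔸) = ι_V(u · 1_V)`**: in `G₁(𝔸) = U(J_V ⊗ J_W)(𝔸)` the archimedean `U(W)`-torus element `a′` of the LINE `W = ⟨a⟩` IS the archimedean
central element `u_{det_∞ a′} · 1_V`, the latter spelt `CMCenter (infUnitToOne (det_∞ a′))` as in (CC₀).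
[cite: GelbartRogawski1991, §3.1 p. 454–455] [cite: BorelJacquet1979, §4.1] -/
theorem adelicInr_archToAdelic_eq_adelicInl_CMCenter
    (a' : UnitaryGroup.arch (↥(maximalRealSubfield L)) (L : Type) (IsCMField.complexConj L) 1 (Matrix.diagonal (lineVec (L : Type) a))) :
    UnitaryGroup.adelicInr (↥(maximalRealSubfield (L : Type))) (L : Type) (IsCMField.complexConj (L : Type)) 3 1 (Matrix.diagonal (frameD V))
        (Matrix.diagonal (lineVec (L : Type) a))
        (UnitaryGroup.archToAdelic (↥(maximalRealSubfield L)) (L : Type) (IsCMField.complexConj L) 1 (Matrix.diagonal (lineVec (L : Type) a)) a') =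
      UnitaryGroup.adelicInl (↥(maximalRealSubfield (L : Type))) (L : Type) (IsCMField.complexConj (L : Type)) 3 1 (Matrix.diagonal (frameD V))
        (Matrix.diagonal (lineVec (L : Type) a))
        (CMCenter (L : Type) (frameD V) (infUnitToOne (L : Type)
          (UnitaryGroup.archDet (↥(maximalRealSubfield L)) (L : Type) (IsCMField.complexConj L) 1 (Matrix.diagonal (lineVec (L : Type) a))
            (Algebra.IsQuadraticExtension.finrank_eq_two _ (L : Type)) (IsCMField.complexConj_ne_one (K := (L : Type)))
            (det_diagonal_lineVec_ne_zero a ha0) a'))) := by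
  rw [Summit.HodgeConjecture.HodgeConjecture.Cruxes.H413.ThetaNonvanishing.adelicInr_archToAdelic_line (↥(maximalRealSubfield L)) (L : Type)
      (IsCMField.complexConj L) (Algebra.IsQuadraticExtension.finrank_eq_two _ (L : Type)) (IsCMField.complexConj_ne_one (K := (L : Type))) 3
      (Matrix.diagonal (frameD V)) (Matrix.diagonal (lineVec (L : Type) a)) (det_diagonal_lineVec_ne_zero a ha0) a',
    UnitaryGroup.archToAdelic_archCenter]
  rfl

variable (μ₀ : Literature.NumberTheory.Automorphic.IdeleClassGroup (L : Type) →ₜ* Circle) (hμ₀ : IsConjugateSymplectic (L : Type) μ₀)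
  (hw : HasWeight (L : Type) μ₀ 1) {Φμ : Literature.AlgebraicGeometry.Motives.CMType (L : Type)} (hΦμ : HasCMType (L : Type) μ₀ Φμ)
  (hΦ : ∀ φ : (L : Type) →+* ℂ, φ ∈ Φμ.1 ↔ 0 < (φ (imagUnit (L : Type) * a)).im)
  (hι₁ : (InfinitePlace.mk ι₁).embedding ∈ Φμ.1)
  (ĉ : UnitaryGroup.adelicPair (↥(maximalRealSubfield (L : Type))) (L : Type) (IsCMField.complexConj (L : Type)) 3 1 (Matrix.diagonal (frameD V))
    (Matrix.diagonal (lineVec (L : Type) a)) →* ℂˣ)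
  (htw : chiSplitting (L : Type) e₁ (frameD V) (frameD_real V) (frameD_ne V) (lineVec (L : Type) a) (fun _ => ha) (fun _ => ha0)
      (toHeckeCharacter (L : Type) μ₀) (isUnitary_toHeckeCharacter (L : Type) μ₀)
      (isSplittingChar_toHeckeCharacter_of_isConjugateSymplectic (L : Type) μ₀ hμ₀) =
    adelicMpCont.twist (↥(maximalRealSubfield (L : Type))) (Fin 3) _
      (splittingOf (↥(maximalRealSubfield (L : Type))) (L : Type) (IsCMField.complexConj (L : Type)) 3 1 e₁
        (Matrix.diagonal (frameD V)) (Matrix.diagonal (lineVec (L : Type) a)) (complexConj_imagUnit (L : Type)) (imagUnit_ne_zero (L : Type))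
        (imagUnit_mul_self (L : Type)) (realDiagonal_isSymm (L : Type) (frameD V) (frameD_real V))
        (realDiagonal_isSymm (L : Type) (lineVec (L : Type) a) (fun _ => ha))
        (isUnit_det_realDiagonal (L : Type) (frameD V) (frameD_real V) (frameD_ne V))
        (isUnit_det_realDiagonal (L : Type) (lineVec (L : Type) a) (fun _ => ha) (fun _ => ha0))
        (realDiagonal_map (L : Type) (frameD V) (frameD_real V)).symm
        (realDiagonal_map (L : Type) (lineVec (L : Type) a) (fun _ => ha)).symm hGR) ĉ)

include hw hΦμ hΦ hι₁ htw in
/-- **`lineC (det_∞ a′) = (ĉ (ι_W (a′)_𝔸))⁻¹`**: (F1)'s centre eigen-character of the splitting of record at `det_∞ a′` IS the inverse of the twist character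
`ĉ` of Liu's `μ`-splitting `ι_μ = s₀ ⊗ ĉ` at the `U(W)`-torus element `a′` — the centre identity (CC₀) for weight one (★ `CC_of_weightOne_of_twist_eq`) read
through `ι_W((a′)_𝔸) = ι_V(u · 1_V)`. [cite: Liu2021, App. D §D.1 Step 3 (l. 5219–5221), Lem. D.2; Def. 4.12] [cite: GelbartRogawski1991, §3.1 p. 454–455, Remark p. 457 L4–13] -/
theorem lineC_archDet_eq_inv_twistChar
    (a' : UnitaryGroup.arch (↥(maximalRealSubfield L)) (L : Type) (IsCMField.complexConj L) 1 (Matrix.diagonal (lineVec (L : Type) a))) :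
    lineC V a ha ha0 hGR
        (UnitaryGroup.archDet (↥(maximalRealSubfield L)) (L : Type) (IsCMField.complexConj L) 1 (Matrix.diagonal (lineVec (L : Type) a))
          (Algebra.IsQuadraticExtension.finrank_eq_two _ (L : Type)) (IsCMField.complexConj_ne_one (K := (L : Type)))
          (det_diagonal_lineVec_ne_zero a ha0) a') =
      (((ĉ (UnitaryGroup.adelicInr (↥(maximalRealSubfield (L : Type))) (L : Type) (IsCMField.complexConj (L : Type)) 3 1 (Matrix.diagonal (frameD V))
          (Matrix.diagonal (lineVec (L : Type) a))
          (UnitaryGroup.archToAdelic (↥(maximalRealSubfield L)) (L : Type) (IsCMField.complexConj L) 1 (Matrix.diagonal (lineVec (L : Type) a)) a')))⁻¹ :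
        ℂˣ) : ℂ) := by
  have hCC := CC_of_weightOne_of_twist_eq V ⟨a, ha, ha0⟩ hGR μ₀ hμ₀ hw hΦμ hΦ hι₁ ĉ htw
    (UnitaryGroup.archDet (↥(maximalRealSubfield L)) (L : Type) (IsCMField.complexConj L) 1 (Matrix.diagonal (lineVec (L : Type) a))
      (Algebra.IsQuadraticExtension.finrank_eq_two _ (L : Type)) (IsCMField.complexConj_ne_one (K := (L : Type)))
      (det_diagonal_lineVec_ne_zero a ha0) a')
  rw [adelicInr_archToAdelic_eq_adelicInl_CMCenter V a ha0, Units.val_inv_eq_inv_val]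
  exact eq_inv_of_mul_eq_one_right hCC

include hw hΦμ hΦ hι₁ htw in
/-- **THE `U(W)`-TORUS ACTS ON THE SLOT FAMILY BY `(ĉ ∘ ι_W)⁻¹` AT `∞`** (model currency, any slot-sign frame `eR, eS`): for every
`a′ ∈ U(⟨a⟩)(L⁺ ⊗ ℝ)` and every covector `ℓ`, `ω_{s₀}(1, a′) Φ_∞(ℓ) = (ĉ (ι_W (a′)_𝔸))⁻¹ • Φ_∞(ℓ)` — ★ `cmArchWeilRep_one_blockFamilyOfAt` with its
scalar `lineC (det_∞ a′)` rewritten by `lineC_archDet_eq_inv_twistChar`.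
[cite: Liu2021, App. D §D.1 Step 3 (l. 5219–5221), Lem. D.2] [cite: KonnoKonno2007, Thm 5.4] [cite: GelbartRogawski1991, §3.1 p. 454–455] -/
theorem cmArchWeilRep_one_blockFamilyOfAt_eq_inv_twistChar_smul {S' : Type} [Fintype S'] [DecidableEq S']
    (eR : PosIdx (cmXW (L : Type) (frameD V) (lineVec (L : Type) a) (fun _ => ha) ι₁ (HypCensus.cmPlace (L : Type) ι₁)) ≃ Unit)
    (eS : NegIdx (cmXW (L : Type) (frameD V) (lineVec (L : Type) a) (fun _ => ha) ι₁ (HypCensus.cmPlace (L : Type) ι₁)) ≃ S')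
    (a' : UnitaryGroup.arch (↥(maximalRealSubfield L)) (L : Type) (IsCMField.complexConj L) 1 (Matrix.diagonal (lineVec (L : Type) a)))
    (ℓ : Module.Dual ℂ (Fin 2 → ℂ)) :
    cmArchWeilRep (L : Type) e₁ (frameD V) (frameD_real V) (frameD_ne V) (lineVec (L : Type) a) (fun _ => ha) (fun _ => ha0) hGR (1, a')
        (blockFamilyOfAt (L : Type) e₁ (frameD V) (frameD_real V) (frameD_ne V) (lineVec (L : Type) a) (fun _ => ha) (fun _ => ha0) ι₁
          (blockPosEquiv V) (blockNegEquiv V) eR eS (degOnePDual S') (binvPi 1) ℓ) =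
      (((ĉ (UnitaryGroup.adelicInr (↥(maximalRealSubfield (L : Type))) (L : Type) (IsCMField.complexConj (L : Type)) 3 1 (Matrix.diagonal (frameD V))
          (Matrix.diagonal (lineVec (L : Type) a))
          (UnitaryGroup.archToAdelic (↥(maximalRealSubfield L)) (L : Type) (IsCMField.complexConj L) 1 (Matrix.diagonal (lineVec (L : Type) a)) a')))⁻¹ :
        ℂˣ) : ℂ) •
        blockFamilyOfAt (L : Type) e₁ (frameD V) (frameD_real V) (frameD_ne V) (lineVec (L : Type) a) (fun _ => ha) (fun _ => ha0) ι₁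
          (blockPosEquiv V) (blockNegEquiv V) eR eS (degOnePDual S') (binvPi 1) ℓ := by
  rw [cmArchWeilRep_one_blockFamilyOfAt V a ha ha0 hGR eR eS a' ℓ,
    lineC_archDet_eq_inv_twistChar V a ha ha0 hGR μ₀ hμ₀ hw hΦμ hΦ hι₁ ĉ htw a']

end Model

/-! ## §2 At the H413 pin, in F0P4-p05's letter: the `heig` input of `chiN_of_rankOneContCM` -/

section Pin

open HodgeCM.Model.LiuIndex HodgeCM.Model.TowerCarrier
open Summit.HodgeConjecture.CorCM Summit.HodgeConjecture.CorCM.Transposition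
open Summit.HodgeConjecture.CorCM.Model
open Literature.AlgebraicGeometry.Motives (CMType)
open Literature.NumberTheory.Automorphic.Liu2021
open Literature.AlgebraicGeometry.Liu2021 (IsAdmissibleElement)
open Summit.HodgeConjecture.CorCM.Lines.A3Liu413 (datum413)
open Summit.HodgeConjecture.HodgeConjecture.Cruxes.H413.AdmissibleLine
open Summit.HodgeConjecture.HodgeConjecture.Cruxes.H413.IndexOrientation (embedding_mk_eq_of_indexOfRecord)

/-- the three pin read-offs F0P4-p01's closer uses, packaged: at an admissible line `(e, a)` of a weight-one triple `t` with `ι₁ ∈ Φ_{μ(t)}`,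
(i) `Φ_{μ(t)}` is the `δ·a`-positive CM type (★ `IsAdmissibleElement.mem_iff_im_pos`), (ii) `(mk ι₁).embedding ∈ Φ_{μ(t)}` (★ `embedding_mk_eq_of_indexOfRecord`).
[cite: Liu2021, Def. 4.12; proof of Prop. 4.13 (l. 2145)] -/
theorem cmType_mem_iff_and_embedding_mem_pin
    (hDel : Literature.AlgebraicGeometry.ShimuraVarieties.UnitaryCanonicalModel.canonicalModel_exists_printed)
    (F : HodgeCM.CMField) [IsGalois ℚ F] {ι₁ : F →+* ℂ} (V : HodgeCM.HermSpace3 F ι₁) (a₀ : RealScalar F)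
    (Φ : CMType F) (i : (I V (repAt a₀) (muLiu ι₁ GramClass.rep)))
    (t : (datum413 hDel F V a₀ Φ i).Triple) (hι : ι₁ ∈ t.cmType.1)
    (e : HodgeCM.CMField.K F) (a : (↥(maximalRealSubfield (HodgeCM.CMField.K F)))ˣ)
    (he : IsAdmissibleElement (HodgeCM.CMField.K F) t.cmType.1 e)
    (hae : ((a : ↥(maximalRealSubfield (HodgeCM.CMField.K F))) : HodgeCM.CMField.K F) = e * (2 * imagUnit (HodgeCM.CMField.K F))) :
    (∀ φ : (HodgeCM.CMField.K F) →+* ℂ, φ ∈ t.cmType.1 ↔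
        0 < (φ (imagUnit (HodgeCM.CMField.K F) * ((a : ↥(maximalRealSubfield (HodgeCM.CMField.K F))) : (HodgeCM.CMField.K F)))).im) ∧
      (InfinitePlace.mk ι₁).embedding ∈ t.cmType.1 := by
  refine ⟨fun φ => ?_, ?_⟩
  · rw [hae]; exact IsAdmissibleElement.mem_iff_im_pos t.cmType he (complexConj_imagUnit _) (imagUnit_ne_zero _) φ
  · rw [embedding_mk_eq_of_indexOfRecord V a₀ i]; exact hι

/-- **(A-PIN) — THE SCALAR**: at the H413 pin, for a weight-one triple `t` with `ι₁ ∈ Φ_{μ(t)}`, an admissible line `(e, a)`, and an adelic pair character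
`ĉ` with Liu's twist equation `ι_{μ(t)} = s₀ ⊗ ĉ`, (F1)'s centre eigen-character satisfies `lineC V ↑a (compat_line₀ …) (det_∞ a′) = (ĉ (ι_W (a′)_𝔸))⁻¹`
for every `a′ ∈ U(⟨a⟩)(L⁺ ⊗ ℝ)`. [cite: Liu2021, App. D §D.1 Step 3 (l. 5219–5221), Lem. D.2; Def. 4.12] [cite: GelbartRogawski1991, §3.1 Remark p. 457 L4–13] -/
theorem lineC_archDet_pin
    (hDel : Literature.AlgebraicGeometry.ShimuraVarieties.UnitaryCanonicalModel.canonicalModel_exists_printed)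
    (F : HodgeCM.CMField) [IsGalois ℚ F] {ι₁ : F →+* ℂ} (V : HodgeCM.HermSpace3 F ι₁) (a₀ : RealScalar F)
    (Φ : CMType F) (i : (I V (repAt a₀) (muLiu ι₁ GramClass.rep)))
    (t : (datum413 hDel F V a₀ Φ i).Triple) (hw : t.HasWeightOne) (hι : ι₁ ∈ t.cmType.1)
    (e : HodgeCM.CMField.K F) (a : (↥(maximalRealSubfield (HodgeCM.CMField.K F)))ˣ)
    (he : IsAdmissibleElement (HodgeCM.CMField.K F) t.cmType.1 e)
    (hae : ((a : ↥(maximalRealSubfield (HodgeCM.CMField.K F))) : HodgeCM.CMField.K F) = e * (2 * imagUnit (HodgeCM.CMField.K F)))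
    (ha : IsCMField.complexConj (HodgeCM.CMField.K F) ((a : ↥(maximalRealSubfield (HodgeCM.CMField.K F))) : (HodgeCM.CMField.K F)) =
      ((a : ↥(maximalRealSubfield (HodgeCM.CMField.K F))) : (HodgeCM.CMField.K F)))
    (ha0 : ((a : ↥(maximalRealSubfield (HodgeCM.CMField.K F))) : (HodgeCM.CMField.K F)) ≠ 0)
    (ĉ : UnitaryGroup.adelicPair (↥(maximalRealSubfield (HodgeCM.CMField.K F))) (HodgeCM.CMField.K F) (IsCMField.complexConj (HodgeCM.CMField.K F)) 3 1
      (Matrix.diagonal (frameD V)) (Matrix.diagonal (lineVec (HodgeCM.CMField.K F) ((a : ↥(maximalRealSubfield (HodgeCM.CMField.K F))) : (HodgeCM.CMField.K F)))) →* ℂˣ)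
    (hĉ : chiSplitting (HodgeCM.CMField.K F) e₁ (frameD V) (frameD_real V) (frameD_ne V)
        (lineVec (HodgeCM.CMField.K F) ((a : ↥(maximalRealSubfield (HodgeCM.CMField.K F))) : (HodgeCM.CMField.K F))) (ThetaJunction.complexConj_lineVec_coe (HodgeCM.CMField.K F) a)
        (ThetaJunction.lineVec_coe_ne_zero (HodgeCM.CMField.K F) a) (Literature.NumberTheory.Automorphic.IdeleClassGroup.toHeckeCharacter (HodgeCM.CMField.K F) t.μ)
        (Literature.NumberTheory.Automorphic.IdeleClassGroup.isUnitary_toHeckeCharacter (HodgeCM.CMField.K F) t.μ)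
        ((Literature.RepresentationTheory.Liu2021.isOscillatorChar_toHeckeCharacter_iff t.μ).mpr t.isConjugateSymplectic) =
      adelicMpCont.twist (↥(maximalRealSubfield (HodgeCM.CMField.K F))) (Fin 3) _
        (splittingOf _ _ _ _ _ _ _ _ _ _ _ _ _ _ _ _ _ (compat_line₀ V Φ ι₁ ((a : ↥(maximalRealSubfield (HodgeCM.CMField.K F))) : (HodgeCM.CMField.K F)) ha ha0)) ĉ)
    (a' : UnitaryGroup.arch (↥(maximalRealSubfield (HodgeCM.CMField.K F))) (HodgeCM.CMField.K F) (IsCMField.complexConj (HodgeCM.CMField.K F)) 1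
      (Matrix.diagonal (lineVec (HodgeCM.CMField.K F) ((a : ↥(maximalRealSubfield (HodgeCM.CMField.K F))) : (HodgeCM.CMField.K F))))) :
    lineC V ((a : ↥(maximalRealSubfield (HodgeCM.CMField.K F))) : (HodgeCM.CMField.K F)) ha ha0
        (compat_line₀ V Φ ι₁ ((a : ↥(maximalRealSubfield (HodgeCM.CMField.K F))) : (HodgeCM.CMField.K F)) ha ha0)
        (UnitaryGroup.archDet (↥(maximalRealSubfield (HodgeCM.CMField.K F))) (HodgeCM.CMField.K F) (IsCMField.complexConj (HodgeCM.CMField.K F)) 1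
          (Matrix.diagonal (lineVec (HodgeCM.CMField.K F) ((a : ↥(maximalRealSubfield (HodgeCM.CMField.K F))) : (HodgeCM.CMField.K F))))
          (Algebra.IsQuadraticExtension.finrank_eq_two _ (HodgeCM.CMField.K F)) (IsCMField.complexConj_ne_one (K := (HodgeCM.CMField.K F)))
          (det_diagonal_lineVec_ne_zero ((a : ↥(maximalRealSubfield (HodgeCM.CMField.K F))) : (HodgeCM.CMField.K F)) ha0) a') =
      (((ĉ (UnitaryGroup.adelicInr (↥(maximalRealSubfield (HodgeCM.CMField.K F))) (HodgeCM.CMField.K F) (IsCMField.complexConj (HodgeCM.CMField.K F)) 3 1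
          (Matrix.diagonal (frameD V)) (Matrix.diagonal (lineVec (HodgeCM.CMField.K F) ((a : ↥(maximalRealSubfield (HodgeCM.CMField.K F))) : (HodgeCM.CMField.K F))))
          (UnitaryGroup.archToAdelic (↥(maximalRealSubfield (HodgeCM.CMField.K F))) (HodgeCM.CMField.K F) (IsCMField.complexConj (HodgeCM.CMField.K F)) 1
            (Matrix.diagonal (lineVec (HodgeCM.CMField.K F) ((a : ↥(maximalRealSubfield (HodgeCM.CMField.K F))) : (HodgeCM.CMField.K F)))) a')))⁻¹ : ℂˣ) : ℂ) := by
  obtain ⟨hΦt, hmem⟩ := cmType_mem_iff_and_embedding_mem_pin hDel F V a₀ Φ i t hι e a he hae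
  exact lineC_archDet_eq_inv_twistChar V ((a : ↥(maximalRealSubfield (HodgeCM.CMField.K F))) : (HodgeCM.CMField.K F)) ha ha0
    (compat_line₀ V Φ ι₁ ((a : ↥(maximalRealSubfield (HodgeCM.CMField.K F))) : (HodgeCM.CMField.K F)) ha ha0) t.μ t.isConjugateSymplectic hw
    t.isConjugateSymplectic.hasCMType_cmType hΦt hmem ĉ hĉ a'

/-- **(A-PIN) — F0P4-p05's LETTER VERBATIM**: at the H413 pin, under the binders `(t hw hι e a he hae) (ha ha0 hpos ĉ hĉ)` of the `(χ)`+`(N)` row `hχN`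
(F0P4-p01's `exists_holTheta_admissibleLine_of_chiN`), the archimedean `U(W)`-torus acts on the slot family through the splitting of record by the INVERSE
of the twist character: `ω_{s₀}(1, a′) Φ_∞(ℓ) = (ĉ (ι_W (a′)_𝔸))⁻¹ • Φ_∞(ℓ)` — the `heig` input of brick 7 at `χ_∞ := (ĉ ∘ ι_W ∘ (·)_𝔸)⁻¹`, the archimedean
component of the pin character `χ₂` of ★ `RallisTransport.exists_pinDual`.
[cite: Liu2021, App. D §D.1 Step 3 (l. 5219–5221), Lem. D.2; Def. 4.12] [cite: KonnoKonno2007, Thm 5.4] [cite: GelbartRogawski1991, §3.1 p. 454–455] -/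
theorem cmArchWeilRep_one_blockFamilyOfAt_pin
    (hDel : Literature.AlgebraicGeometry.ShimuraVarieties.UnitaryCanonicalModel.canonicalModel_exists_printed)
    (F : HodgeCM.CMField) [IsGalois ℚ F] {ι₁ : F →+* ℂ} (V : HodgeCM.HermSpace3 F ι₁) (a₀ : RealScalar F)
    (Φ : CMType F) (i : (I V (repAt a₀) (muLiu ι₁ GramClass.rep)))
    (t : (datum413 hDel F V a₀ Φ i).Triple) (hw : t.HasWeightOne) (hι : ι₁ ∈ t.cmType.1)
    (e : HodgeCM.CMField.K F) (a : (↥(maximalRealSubfield (HodgeCM.CMField.K F)))ˣ)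
    (he : IsAdmissibleElement (HodgeCM.CMField.K F) t.cmType.1 e)
    (hae : ((a : ↥(maximalRealSubfield (HodgeCM.CMField.K F))) : HodgeCM.CMField.K F) = e * (2 * imagUnit (HodgeCM.CMField.K F)))
    (ha : IsCMField.complexConj (HodgeCM.CMField.K F) ((a : ↥(maximalRealSubfield (HodgeCM.CMField.K F))) : (HodgeCM.CMField.K F)) =
      ((a : ↥(maximalRealSubfield (HodgeCM.CMField.K F))) : (HodgeCM.CMField.K F)))
    (ha0 : ((a : ↥(maximalRealSubfield (HodgeCM.CMField.K F))) : (HodgeCM.CMField.K F)) ≠ 0)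
    (hpos : 0 < cmXW (HodgeCM.CMField.K F) (frameD V) (lineVec (HodgeCM.CMField.K F) (dW (cDiag Φ ι₁ ((a : ↥(maximalRealSubfield (HodgeCM.CMField.K F))) :
        (HodgeCM.CMField.K F)) ha ha0).D 0)) (fun _ => dW_real (cDiag Φ ι₁ ((a : ↥(maximalRealSubfield (HodgeCM.CMField.K F))) : (HodgeCM.CMField.K F)) ha ha0).D 0)
        ι₁ (cmPlace (HodgeCM.CMField.K F) ι₁) 0)
    (ĉ : UnitaryGroup.adelicPair (↥(maximalRealSubfield (HodgeCM.CMField.K F))) (HodgeCM.CMField.K F) (IsCMField.complexConj (HodgeCM.CMField.K F)) 3 1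
      (Matrix.diagonal (frameD V)) (Matrix.diagonal (lineVec (HodgeCM.CMField.K F) ((a : ↥(maximalRealSubfield (HodgeCM.CMField.K F))) : (HodgeCM.CMField.K F)))) →* ℂˣ)
    (hĉ : chiSplitting (HodgeCM.CMField.K F) e₁ (frameD V) (frameD_real V) (frameD_ne V)
        (lineVec (HodgeCM.CMField.K F) ((a : ↥(maximalRealSubfield (HodgeCM.CMField.K F))) : (HodgeCM.CMField.K F))) (ThetaJunction.complexConj_lineVec_coe (HodgeCM.CMField.K F) a)
        (ThetaJunction.lineVec_coe_ne_zero (HodgeCM.CMField.K F) a) (Literature.NumberTheory.Automorphic.IdeleClassGroup.toHeckeCharacter (HodgeCM.CMField.K F) t.μ)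
        (Literature.NumberTheory.Automorphic.IdeleClassGroup.isUnitary_toHeckeCharacter (HodgeCM.CMField.K F) t.μ)
        ((Literature.RepresentationTheory.Liu2021.isOscillatorChar_toHeckeCharacter_iff t.μ).mpr t.isConjugateSymplectic) =
      adelicMpCont.twist (↥(maximalRealSubfield (HodgeCM.CMField.K F))) (Fin 3) _
        (splittingOf _ _ _ _ _ _ _ _ _ _ _ _ _ _ _ _ _ (compat_line₀ V Φ ι₁ ((a : ↥(maximalRealSubfield (HodgeCM.CMField.K F))) : (HodgeCM.CMField.K F)) ha ha0)) ĉ)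
    (a' : UnitaryGroup.arch (↥(maximalRealSubfield (HodgeCM.CMField.K F))) (HodgeCM.CMField.K F) (IsCMField.complexConj (HodgeCM.CMField.K F)) 1
      (Matrix.diagonal (lineVec (HodgeCM.CMField.K F) ((a : ↥(maximalRealSubfield (HodgeCM.CMField.K F))) : (HodgeCM.CMField.K F)))))
    (ℓ : Module.Dual ℂ (Fin 2 → ℂ)) :
    cmArchWeilRep (HodgeCM.CMField.K F) e₁ (frameD V) (frameD_real V) (frameD_ne V)
        (lineVec (HodgeCM.CMField.K F) ((a : ↥(maximalRealSubfield (HodgeCM.CMField.K F))) : (HodgeCM.CMField.K F))) (fun _ => ha) (fun _ => ha0)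
        (compat_line₀ V Φ ι₁ ((a : ↥(maximalRealSubfield (HodgeCM.CMField.K F))) : (HodgeCM.CMField.K F)) ha ha0) (1, a')
        (blockFamilyOfAt (HodgeCM.CMField.K F) e₁ (frameD V) (frameD_real V) (frameD_ne V)
          (lineVec (HodgeCM.CMField.K F) (dW (cDiag Φ ι₁ ((a : ↥(maximalRealSubfield (HodgeCM.CMField.K F))) : (HodgeCM.CMField.K F)) ha ha0).D 0))
          (fun _ => dW_real (cDiag Φ ι₁ ((a : ↥(maximalRealSubfield (HodgeCM.CMField.K F))) : (HodgeCM.CMField.K F)) ha ha0).D 0)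
          (fun _ => dW_ne (cDiag Φ ι₁ ((a : ↥(maximalRealSubfield (HodgeCM.CMField.K F))) : (HodgeCM.CMField.K F)) ha ha0).D 0) ι₁ (blockPosEquiv V) (blockNegEquiv V)
          (posIdxEquivUnit hpos) (negIdxEquivEmpty hpos) (degOnePDual Empty) (binvPi 1) ℓ) =
      (((ĉ (UnitaryGroup.adelicInr (↥(maximalRealSubfield (HodgeCM.CMField.K F))) (HodgeCM.CMField.K F) (IsCMField.complexConj (HodgeCM.CMField.K F)) 3 1
          (Matrix.diagonal (frameD V)) (Matrix.diagonal (lineVec (HodgeCM.CMField.K F) ((a : ↥(maximalRealSubfield (HodgeCM.CMField.K F))) : (HodgeCM.CMField.K F))))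
          (UnitaryGroup.archToAdelic (↥(maximalRealSubfield (HodgeCM.CMField.K F))) (HodgeCM.CMField.K F) (IsCMField.complexConj (HodgeCM.CMField.K F)) 1
            (Matrix.diagonal (lineVec (HodgeCM.CMField.K F) ((a : ↥(maximalRealSubfield (HodgeCM.CMField.K F))) : (HodgeCM.CMField.K F)))) a')))⁻¹ : ℂˣ) : ℂ) •
        blockFamilyOfAt (HodgeCM.CMField.K F) e₁ (frameD V) (frameD_real V) (frameD_ne V)
          (lineVec (HodgeCM.CMField.K F) (dW (cDiag Φ ι₁ ((a : ↥(maximalRealSubfield (HodgeCM.CMField.K F))) : (HodgeCM.CMField.K F)) ha ha0).D 0))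
          (fun _ => dW_real (cDiag Φ ι₁ ((a : ↥(maximalRealSubfield (HodgeCM.CMField.K F))) : (HodgeCM.CMField.K F)) ha ha0).D 0)
          (fun _ => dW_ne (cDiag Φ ι₁ ((a : ↥(maximalRealSubfield (HodgeCM.CMField.K F))) : (HodgeCM.CMField.K F)) ha ha0).D 0) ι₁ (blockPosEquiv V) (blockNegEquiv V)
          (posIdxEquivUnit hpos) (negIdxEquivEmpty hpos) (degOnePDual Empty) (binvPi 1) ℓ := by
  obtain ⟨hΦt, hmem⟩ := cmType_mem_iff_and_embedding_mem_pin hDel F V a₀ Φ i t hι e a he hae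
  exact cmArchWeilRep_one_blockFamilyOfAt_eq_inv_twistChar_smul V ((a : ↥(maximalRealSubfield (HodgeCM.CMField.K F))) : (HodgeCM.CMField.K F)) ha ha0
    (compat_line₀ V Φ ι₁ ((a : ↥(maximalRealSubfield (HodgeCM.CMField.K F))) : (HodgeCM.CMField.K F)) ha ha0) t.μ t.isConjugateSymplectic hw
    t.isConjugateSymplectic.hasCMType_cmType hΦt hmem ĉ hĉ (posIdxEquivUnit hpos) (negIdxEquivEmpty hpos) a' ℓ

end Pin

end Summit.HodgeConjecture.HodgeConjecture.Cruxes.H413.ThetaDistAtLine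

end
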